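import Summits.BirchSwinnertonDyer.BirchSwinnertonDyer.Theorems.SignedLowerHalvesKobayashiMainConjectureSmallImageTeichOrbitMu
import Summits.BirchSwinnertonDyer.BirchSwinnertonDyer.Theorems.SignedLowerHalvesKobayashiMainConjectureSmallImageTeichSpanLevelDescent
import HarnessLib

/-!
# Route `SignedLowerHalves`, crux `KobayashiMainConjectureSmallImage` (item stmt-BirchSwinnertonDyer-19002),
# line `birth_acns` v11, stub `stub_muOneSign_ns_ge5`: **the exact hinge of the `p ≥ 5` one-sign μ-rider is B⁰ AT ONE LEVEL —
# the conductor of the pair, or any multiple of it prime to `p`** (cell `bsd-ssimc`, seat `bsd-line-slh-p3` gen 9, LEAD;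
# THEOREMS ONLY; helper `--supports stmt-BirchSwinnertonDyer-19002`)

State before this file (gen 8, p645198 `…SmallImageTeichOrbitMu.lean`): `stub_muOneSign_ns_ge5` ⟸ `TeichSpanGenAll` = CONJ B⁰ at EVERY
level `N` prime to `p` and every `p ≥ 5` (cell `bsd-f3-mu`; OPEN — it contains Perrin-Riou's conjecture `μ^±(g, ω⁰) = 0`,
Pollack–Weston 2011 Thm. 4.1 / Rem. 4.2, for every weight-2 eigenform of every level).  That hypothesis is far wider than the
rider needs.  This file records the SHARP by-name reduction, in the tree's vocabulary and with no new definition: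

* `exists_sign_hasUnitContent_of_exists_teichOrbitSum_sub` (§1, any odd supersingular `p`) — per NEWFORM: one explicit pair of
  Teichmüller-orbit sums `S_f(p,n,a), S_f(p,n,a′)` (`n ≥ 1`) differing by a rational of `p`-adic norm `≥ 1` already gives
  `∃ ε L, IsSignedPAdicLFunction f p ε L ∧ HasUnitContent L` (the proof of p645198's
  `exists_sign_hasUnitContent_of_teichOrbitNonConstantAt`, run on the newform's own datum instead of the curve predicate
  `TeichOrbitNonConstantAt W p`).
* `exists_sign_hasUnitContent_of_teichSpanGen` (§2, `p ≥ 5`) — **B⁰ at the newform's OWN level `N` suffices**: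
  `TeichSpanGen N p →` (good supersingular `p ≥ 5`, `a_p = 0`) the one-sign rider for `f`.  Inputs, all tree theorems:
  Serre's Prop. 12 (`E[p]` irreducible at a good supersingular prime), the input-free THEOREM B road
  (`EvenBranch.cycWindingNonConstantAt_of_odd`), the Eisenstein multiple from irreducibility
  (`exists_intCast_mul_modularSymbol_zero_mem`), and the LEVEL FORM of the f3-mu dictionary
  (`TeichSpan.exists_teichOrbitSum_sub_of_teichSpanGen`, `…TeichOrbitNonConstantAtOfTeichSpanGenAll.lean`).
* `exists_sign_hasUnitContent_of_teichSpanGen_of_dvd` (§3) — **B⁰ at ANY ONE multiple `N′` of the level with `p ∤ N′` suffices**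
  (level descent `SmallImageTeichSpanLevelDescent.teichSpanGen_of_dvd`, the ideator bsd-idea-13 g11's lemma landed by this seat):
  an attack may work at a torsion-free level `4N`, or with an auxiliary prime in the level.
* `muOneSign_ns_ge5_of_teichSpanGen_conductor` / `muOneSign_ns_ge5_of_teichSpanGen_conductor_mul` (§4) — the registered stub
  `stub_muOneSign_ns_ge5` of `Lines/birth_acns.lean` v11, VERBATIM, from «B⁰ at the conductor level (resp. at some multiple of it
  prime to `p`) of every pair of the class» — a hypothesis quantified over the crux's OWN population only (non-CM `E/ℚ` in class X7,
  good supersingular `p ≥ 5`, `a_p = 0`, `ρ̄_{E,p}` not surjective), not over all levels.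
HONEST SCOPE: nothing here proves B⁰ at any level; the stub is NOT discharged; per pair the hinge remains the finite modular-symbol
statement `TeichOrbitNonConstantAt W p` (§1), class-wide it is Perrin-Riou's one-signed `μ`-conjecture on this population.  Crux 4
stays OPEN; BSD is not proved by any of this; no summit statement is proved by this seat.
References: [MazurTateTeitelbaum1986Invent] §I.10 (10.1)–(10.2); [Pollack2003] Def. 6.15, Rem. 6.16; [PollackWeston2011] Thm. 4.1 (1),
Rem. 4.2; [Serre1972] §1.11 Prop. 12; [Manin1972] Prop. 1.4.
-/

-- D-0017: single-problem summit, the namespace repeats the problem name by design.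
set_option linter.dupNamespace false
set_option autoImplicit false

noncomputable section

open scoped Classical MatrixGroups ModularForm

open Polynomial CongruenceSubgroup Literature.NumberTheory.EllipticCurves Literature.NumberTheory.EllipticCurves.ModularForms
  Literature.NumberTheory.EllipticCurves.Kobayashi2003 Literature.NumberTheory.EllipticCurves.GreenbergVatsal2000
  Literature.NumberTheory.EllipticCurves.Rank1Residual

namespace Summit.BirchSwinnertonDyer.BirchSwinnertonDyer.Theorems.SmallImageTeichOrbitMuLevel

open Summit.BirchSwinnertonDyer.BirchSwinnertonDyer.Theorems.SmallImageOrbitSumMu (exists_sign_hasUnitContent_of_norm_coeff_eq_one)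
open Summit.BirchSwinnertonDyer.BirchSwinnertonDyer.Theorems.SmallImageTeichOrbitMu
  (teichOrbitSum_eq_coeff_comp_mazurTateElement norm_teichOrbitSum_le_one)
open Summit.BirchSwinnertonDyer.BirchSwinnertonDyer.Cruxes.AnalyticMuZeroX9.TeichSpan
  (TeichSpanGen exists_teichOrbitSum_sub_of_teichSpanGen)
open Summit.BirchSwinnertonDyer.BirchSwinnertonDyer.Theorems.SmallImageTeichSpanLevelDescent (teichSpanGen_of_dvd)

variable {N : ℕ} [NeZero N] (f : CuspForm (Gamma0 N) 2) {p : ℕ} [Fact p.Prime]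

/-! ## §1 Per newform: one explicit orbit-sum difference of norm `≥ 1` ⇒ a signed Pollack function with unit content -/

/-- **Per-newform form of p645198's §2** (any odd supersingular prime): for `W/ℚ` globally minimal with good reduction at the odd
prime `p`, `a_p = 0`, its newform `f` of level `N`, and ONE pair of Teichmüller-orbit sums `S_f(p,n,a)`, `S_f(p,n,a′)` (`n ≥ 1`,
`a, a′` units mod `pⁿ`) whose difference has `p`-adic norm `≥ 1`: `∃ ε L, IsSignedPAdicLFunction f p ε L ∧ HasUnitContent L`.
(Ultrametricity + `p`-integrality of orbit sums ⇒ one of the two is a unit; `b = η̄₀γˢ`; the orbit sum IS a group-ring coefficient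
of Pollack's ω⁰ Mazur–Tate element `θ_{n−1}`; a unit coefficient forces one signed function with unit content, p636207.)
[cite: MazurTateTeitelbaum1986Invent, §I.10 (10.1)] [cite: Pollack2003, Def. 6.15 and Remark 6.16] [cite: PollackWeston2011, Thm. 4.1 (1)] -/
theorem exists_sign_hasUnitContent_of_exists_teichOrbitSum_sub {W : WeierstrassCurve ℚ} [W.IsElliptic] [W.IsGloballyMinimal]
    (hp2 : p ≠ 2) (hf : IsNewformOf W f) (hgood : W.HasGoodReductionAtPrime p) (hap : W.frobeniusTrace p = 0)
    (hT : ∃ n : ℕ, 1 ≤ n ∧ ∃ a a' : (ZMod (p ^ n))ˣ,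
      1 ≤ ‖((teichOrbitSum f p n (a : ZMod (p ^ n)) - teichOrbitSum f p n (a' : ZMod (p ^ n)) : ℚ) : ℚ_[p])‖) :
    ∃ (ε : ℤˣ) (L : IwasawaAlgebra p), IsSignedPAdicLFunction f p ε L ∧ HasUnitContent L := by
  have hp : p.Prime := Fact.out
  have hpN : ¬ p ∣ N := not_dvd_level_of_isNewformOf hf hgood
  have hap' : cuspCoeff f p = ((0 : ℤ) : ℂ) := by
    rw [cuspCoeff_eq_frobeniusTrace_of_isNewformOf_holds hf hgood, hap]
  obtain ⟨m, hm, a, a', h1⟩ := hT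
  -- one of the two orbit sums is a `p`-adic unit
  have hone : ∃ b : (ZMod (p ^ m))ˣ, ‖((teichOrbitSum f p m (b : ZMod (p ^ m)) : ℚ) : ℚ_[p])‖ = 1 := by
    have hmax : 1 ≤ max ‖((teichOrbitSum f p m (a : ZMod (p ^ m)) : ℚ) : ℚ_[p])‖
        ‖((teichOrbitSum f p m (a' : ZMod (p ^ m)) : ℚ) : ℚ_[p])‖ := by
      refine le_trans h1 ?_
      push_cast
      rw [sub_eq_add_neg]
      refine le_trans (IsUltrametricDist.norm_add_le_max _ _) ?_
      rw [norm_neg]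
    rcases le_max_iff.mp hmax with ha | ha'
    · exact ⟨a, le_antisymm (norm_teichOrbitSum_le_one f hp2 hf.1 hpN hap' m _) ha⟩
    · exact ⟨a', le_antisymm (norm_teichOrbitSum_le_one f hp2 hf.1 hpN hap' m _) ha'⟩
  obtain ⟨b, hb1⟩ := hone
  obtain ⟨n, rfl⟩ : ∃ n, m = n + 1 := ⟨m - 1, by omega⟩
  -- `b = η̄₀ γˢ`
  obtain ⟨ξ₀, s, hb⟩ := exists_coe_eq_toZModPow_mul_pow hp2 n b
  have hs : s.val < p ^ n := by
    haveI : NeZero (p ^ n) := ⟨pow_ne_zero _ hp.ne_zero⟩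
    exact ZMod.val_lt s
  rw [teichOrbitSum_eq_coeff_comp_mazurTateElement f hp2 n ξ₀ hs (b : ZMod (p ^ (n + 1))) hb] at hb1
  exact exists_sign_hasUnitContent_of_norm_coeff_eq_one hp2 hf hgood hap hb1

/-! ## §2 At `p ≥ 5`: B⁰ at the newform's OWN level suffices -/

/-- **The one-sign μ-rider at a supersingular `p ≥ 5` ⟸ B⁰ AT THE LEVEL OF THE NEWFORM.**  For `W/ℚ` globally minimal with good
reduction at `p ≥ 5`, `a_p = 0`, its newform `f` of level `N` (so `p ∤ N`), and CONJ B⁰ at the single pair `(N, p)`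
(`TeichSpanGen N p`, a hypothesis): `∃ ε L, IsSignedPAdicLFunction f p ε L ∧ HasUnitContent L`.  Chain: `E[p]` irreducible (Serre Prop. 12
at a good supersingular prime) ⇒ winding non-constancy mod `p` (input-free THEOREM B road) and an Eisenstein multiple `n₀{∞,0} ∈ Λ_f` prime
to `p`; the f3-mu dictionary in LEVEL FORM turns B⁰ at `(N,p)` into two orbit sums differing mod `p`; then §1.
[cite: Serre1972, §1.11 Prop. 12] [cite: MazurTateTeitelbaum1986Invent, §I.10 (10.1)–(10.2)] [cite: Manin1972, Prop. 1.4] -/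
theorem exists_sign_hasUnitContent_of_teichSpanGen {W : WeierstrassCurve ℚ} [W.IsElliptic] [W.IsGloballyMinimal]
    (hp5 : 5 ≤ p) (hf : IsNewformOf W f) (hgood : W.HasGoodReductionAtPrime p) (hap : W.frobeniusTrace p = 0)
    (hB : TeichSpanGen N p) :
    ∃ (ε : ℤˣ) (L : IwasawaAlgebra p), IsSignedPAdicLFunction f p ε L ∧ HasUnitContent L := by
  have hp : p.Prime := Fact.out
  have hp2 : p ≠ 2 := by omega
  have hpN : ¬ p ∣ N := not_dvd_level_of_isNewformOf hf hgood
  have hirr : W.HasIrreducibleModPGaloisRep p :=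
    hasIrreducibleModPGaloisRep_of_dvd_frobeniusTrace W p hp2
      (W.not_dvd_minimalDiscriminantInt_of_hasGoodReductionAtPrime' p hgood) (by rw [hap]; exact dvd_zero _)
  have hcyc : CycWindingNonConstantAt W p :=
    Summit.BirchSwinnertonDyer.BirchSwinnertonDyer.Rank1Residual.EvenBranch.cycWindingNonConstantAt_of_odd W p hp2 hgood hirr
  obtain ⟨n₀, hpn₀, h0⟩ :=
    exists_intCast_mul_modularSymbol_zero_mem not_irreducible_of_frobeniusTrace_congr_holds hf hirr
  exact exists_sign_hasUnitContent_of_exists_teichOrbitSum_sub f hp2 hf hgood hap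
    (exists_teichOrbitSum_sub_of_teichSpanGen hf.1 hf.coeffField_eq_bot hp2 hpN
      (cuspCoeff_eq_frobeniusTrace_of_isNewformOf_holds hf hgood) hpn₀ h0 hB (hcyc f hf))

/-! ## §3 B⁰ at ANY ONE multiple of the level prime to `p` suffices (level descent) -/

/-- **The one-sign μ-rider at a supersingular `p ≥ 5` ⟸ B⁰ at ANY ONE LEVEL `N′` with `N ∣ N′`, `p ∤ N′`** (e.g. the torsion-free
level `4N`, or `qN` with an auxiliary prime `q ≠ p`): level descent `teichSpanGen_of_dvd` (bsd-idea-13 g11) + §2.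
[cite: Manin1972, Prop. 1.4] [cite: MazurTateTeitelbaum1986Invent, §I.10 (10.1)] -/
theorem exists_sign_hasUnitContent_of_teichSpanGen_of_dvd {W : WeierstrassCurve ℚ} [W.IsElliptic] [W.IsGloballyMinimal]
    (hp5 : 5 ≤ p) (hf : IsNewformOf W f) (hgood : W.HasGoodReductionAtPrime p) (hap : W.frobeniusTrace p = 0)
    {N' : ℕ} (hNN' : N ∣ N') (hpN' : ¬ p ∣ N') (hB : TeichSpanGen N' p) :
    ∃ (ε : ℤˣ) (L : IwasawaAlgebra p), IsSignedPAdicLFunction f p ε L ∧ HasUnitContent L :=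
  exists_sign_hasUnitContent_of_teichSpanGen f hp5 hf hgood hap (teichSpanGen_of_dvd hNN' Fact.out hpN' hB)

/-! ## §4 The registered stub, VERBATIM, from B⁰ on the crux's own population of levels -/

/-- **`stub_muOneSign_ns_ge5` of line `birth_acns` v11, VERBATIM, from «B⁰ at the CONDUCTOR LEVEL of every pair of the class»**:
the hypothesis quantifies over the crux's population only (class X7, non-CM, good supersingular `p ≥ 5` with `a_p = 0`, `ρ̄_{E,p}` not
surjective) and asks `TeichSpanGen N_E p` there — strictly inside `TeichSpanGenAll`.  The class hypotheses are passed through unused.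
[cite: MazurTateTeitelbaum1986Invent, §I.10 (10.1)] [cite: PollackWeston2011, Thm. 4.1 (1)] -/
theorem muOneSign_ns_ge5_of_teichSpanGen_conductor
    (hB : ∀ (W : WeierstrassCurve ℚ) [W.IsElliptic] [W.IsGloballyMinimal] (p : ℕ) [Fact p.Prime], 5 ≤ p →
      ClassX7 W p → ¬ W.HasCM → W.frobeniusTrace p = 0 → ¬ Surj W p → TeichSpanGen (W.conductorNorm ℤ) p) :
    ∀ (W : WeierstrassCurve ℚ) [W.IsElliptic] [W.IsGloballyMinimal] (p : ℕ) [Fact p.Prime], 5 ≤ p →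
    ClassX7 W p → ¬ W.HasCM → W.frobeniusTrace p = 0 → ¬ Surj W p →
    ∀ [NeZero (W.conductorNorm ℤ)] (f : CuspForm (Gamma0 (W.conductorNorm ℤ)) 2),
    IsNewformOf W f → ∃ (ε₀ : ℤˣ) (L₀ : IwasawaAlgebra p), IsSignedPAdicLFunction f p ε₀ L₀ ∧ HasUnitContent L₀ := by
  intro W _ _ p _ hp5 hX hCM hap hs _ f hf
  exact exists_sign_hasUnitContent_of_teichSpanGen f hp5 hf hX.1.1 hap (hB W p hp5 hX hCM hap hs)

/-- **`stub_muOneSign_ns_ge5` VERBATIM from «B⁰ at SOME multiple of the conductor prime to `p`, for every pair of the class»** (the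
attacker chooses the auxiliary level per pair: `4N_E`, `qN_E`, …).  [cite: Manin1972, Prop. 1.4] [cite: MazurTateTeitelbaum1986Invent, §I.10 (10.1)] -/
theorem muOneSign_ns_ge5_of_teichSpanGen_conductor_mul
    (hB : ∀ (W : WeierstrassCurve ℚ) [W.IsElliptic] [W.IsGloballyMinimal] (p : ℕ) [Fact p.Prime], 5 ≤ p →
      ClassX7 W p → ¬ W.HasCM → W.frobeniusTrace p = 0 → ¬ Surj W p →
        ∃ M : ℕ, ¬ p ∣ M * W.conductorNorm ℤ ∧ TeichSpanGen (M * W.conductorNorm ℤ) p) :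
    ∀ (W : WeierstrassCurve ℚ) [W.IsElliptic] [W.IsGloballyMinimal] (p : ℕ) [Fact p.Prime], 5 ≤ p →
    ClassX7 W p → ¬ W.HasCM → W.frobeniusTrace p = 0 → ¬ Surj W p →
    ∀ [NeZero (W.conductorNorm ℤ)] (f : CuspForm (Gamma0 (W.conductorNorm ℤ)) 2),
    IsNewformOf W f → ∃ (ε₀ : ℤˣ) (L₀ : IwasawaAlgebra p), IsSignedPAdicLFunction f p ε₀ L₀ ∧ HasUnitContent L₀ := by
  intro W _ _ p _ hp5 hX hCM hap hs _ f hf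
  obtain ⟨M, hpM, hBM⟩ := hB W p hp5 hX hCM hap hs
  exact exists_sign_hasUnitContent_of_teichSpanGen_of_dvd f hp5 hf hX.1.1 hap (Dvd.intro_left M rfl) hpM hBM

end Summit.BirchSwinnertonDyer.BirchSwinnertonDyer.Theorems.SmallImageTeichOrbitMuLevel

end
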